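import Literature.NumberTheory.LFunctions.WeilFinitePrimeQuadratic
import HarnessLib

/-!
# RiemannHypothesis / GroundBarta machinery — PHANTOM RIPPLES: frequencies outside the window are invisible

Helper file (`--supports stmt-RiemannHypothesis-18085`; infrastructure for the Weil-positivity ladder of routes
GroundBarta / WeilParity / WeilPos), RH-free, axioms standard.  Seat rh-explicit-weil-1.  For a test function `g` with `tsupport g ⊆ [-c, c]` the kernel
`k = g ⋆ g̃` is supported in `[-2c, 2c]`, hence `k(±x) = 0` whenever `2c ≤ |x|`; by Mellin (Fourier) inversion
on the critical line (`weilConv_weilReflect_add_eq_integral`, in the tree) this says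

`∫ |ĝ(1/2+it)|² · 2cos(t x) dt = 0`   for every `x` with `2c ≤ |x|`.

This is the mechanism by which the prime powers `n ≥ e^{2c}` drop out of the explicit formula on the window
(`weilPrimeTerm_eq_sum_of_tsupport_subset`); read the other way it says that the frequency-side WEIGHT of every
analytic form `(1/2π) ∫ |ĝ(1/2+it)|² w(t) dt` may be modified by an arbitrary finite cosine sum
`P(t) = Σ_m A_m cos(t x_m)` with all `|x_m| ≥ 2c` — a *phantom ripple* — without changing the functional on the
cone `C(c)`:

* `integral_norm_sq_weilMellin_mul_two_cos_eq_zero` — one frequency;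
* `phantomRipple`, `integral_norm_sq_weilMellin_mul_phantomRipple_eq_zero` — finite cosine sums;
* `integral_norm_sq_weilMellin_mul_add_phantomRipple` — `∫ |ĝ|² (w + P) = ∫ |ĝ|² w` for any admissible weight `w`
  (in particular the finite-prime weights `weilFinitePrimeWeight N`, `weilTwoPrimeWeight`).

Use (certificate side): a moment certificate bounds the frequency tail `|t| ≥ T` by the pointwise level
`inf_{|t| ≥ T} w(t)`; replacing `w` by `w + P` is free, and `inf (w + P)` can be much larger than `inf w` because the
prime ripples `−(2Λ(n)/√n) cos(t log n)` of `w` align only on a set that no `|ĝ|²`, `g ∈ C(c)`, can concentrate on.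
Everything here is proved; there are no named facts.

## References

* H. Yoshida, *On Hermitian forms attached to zeta functions*, Adv. Stud. Pure Math. 21 (1992), §2 (2.1), §6.
* E. Bombieri, *Remarks on Weil's quadratic functional in the theory of prime numbers I*, Rend. Mat. Acc. Lincei
  (9) 11 (2000), Thm 2, §2.
-/

noncomputable section

open Complex Filter Set MeasureTheory
open scoped Real Topology ComplexConjugate

namespace Summit.RiemannHypothesis.RiemannHypothesis.Theorems.EvenWinsBeyondArch

open Literature.NumberTheory.LFunctions

variable {g : ℝ → ℂ}

/-! ## One frequency outside the window -/

/-- The kernel `k = g ⋆ g̃` of a test function supported in `[-c, c]` vanishes at every `x` with `2c ≤ |x|`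
(its support is open inside the closed window `[-2c, 2c]`). [folklore] -/
theorem weilConv_weilReflect_eq_zero_of_two_mul_le_abs (hg : IsWeilTest g) {c x : ℝ}
    (hsupp : tsupport g ⊆ Icc (-c) c) (hx : 2 * c ≤ |x|) : weilConv g (weilReflect g) x = 0 := by
  have hk : IsWeilTest (weilConv g (weilReflect g)) := hg.weilConv hg.weilReflect
  have hks : tsupport (weilConv g (weilReflect g)) ⊆ Icc (-(2 * c)) (2 * c) :=
    tsupport_weilConv_weilReflect_subset hg.2 hsupp
  have hIoo : Function.support (weilConv g (weilReflect g)) ⊆ Ioo (-(2 * c)) (2 * c) :=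
    support_subset_Ioo_of_tsupport_subset_Icc hk.1.continuous hks
  by_contra hne
  have hmem := hIoo (Function.mem_support.2 hne)
  rw [mem_Ioo] at hmem
  have : |x| < 2 * c := abs_lt.2 ⟨hmem.1, hmem.2⟩
  linarith

/-- **A frequency outside the window is invisible**: for `tsupport g ⊆ [-c, c]` and `2c ≤ |x|`,
`∫ |ĝ(1/2+it)|² · 2cos(t x) dt = 0`. [folklore] -/
theorem integral_norm_sq_weilMellin_mul_two_cos_eq_zero (hg : IsWeilTest g) {c x : ℝ}
    (hsupp : tsupport g ⊆ Icc (-c) c) (hx : 2 * c ≤ |x|) :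
    ∫ t : ℝ, ‖weilMellin g (1 / 2 + t * I)‖ ^ 2 * (2 * Real.cos (t * x)) = 0 := by
  have h := weilConv_weilReflect_add_eq_integral hg x
  have hx' : 2 * c ≤ |(-x)| := by rwa [abs_neg]
  rw [weilConv_weilReflect_eq_zero_of_two_mul_le_abs hg hsupp hx,
    weilConv_weilReflect_eq_zero_of_two_mul_le_abs hg hsupp hx', add_zero] at h
  have hpi : (1 / (2 * π) : ℂ) ≠ 0 := by
    have : (0 : ℝ) < 2 * π := by positivity
    apply one_div_ne_zero
    exact_mod_cast this.ne'
  have h0 := (mul_eq_zero.1 h.symm).resolve_left hpi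
  exact_mod_cast h0

/-- Scaled version: `∫ |ĝ(1/2+it)|² · (A cos(t x)) dt = 0` for `2c ≤ |x|`. [folklore] -/
theorem integral_norm_sq_weilMellin_mul_const_mul_cos_eq_zero (hg : IsWeilTest g) {c x : ℝ} (A : ℝ)
    (hsupp : tsupport g ⊆ Icc (-c) c) (hx : 2 * c ≤ |x|) :
    ∫ t : ℝ, ‖weilMellin g (1 / 2 + t * I)‖ ^ 2 * (A * Real.cos (t * x)) = 0 := by
  have h := integral_norm_sq_weilMellin_mul_two_cos_eq_zero hg hsupp hx
  have e : (fun t : ℝ ↦ ‖weilMellin g (1 / 2 + t * I)‖ ^ 2 * (A * Real.cos (t * x))) =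
      fun t : ℝ ↦ (A / 2) * (‖weilMellin g (1 / 2 + t * I)‖ ^ 2 * (2 * Real.cos (t * x))) := by
    funext t; ring
  rw [e, integral_const_mul, h, mul_zero]

/-! ## Finite cosine sums outside the window (phantom ripples) -/

/-- A **phantom ripple**: a finite cosine sum `P(t) = Σ_m A_m cos(t x_m)` given by a list of
(amplitude, frequency) pairs. [folklore] -/
def phantomRipple (ps : List (ℝ × ℝ)) (t : ℝ) : ℝ :=
  (ps.map fun p ↦ p.1 * Real.cos (t * p.2)).sum

/-- `phantomRipple [] = 0`. [folklore] -/
@[simp] theorem phantomRipple_nil (t : ℝ) : phantomRipple [] t = 0 := by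
  simp [phantomRipple]

/-- `phantomRipple (p :: ps) t = A cos(t x) + phantomRipple ps t`. [folklore] -/
@[simp] theorem phantomRipple_cons (p : ℝ × ℝ) (ps : List (ℝ × ℝ)) (t : ℝ) :
    phantomRipple (p :: ps) t = p.1 * Real.cos (t * p.2) + phantomRipple ps t := by
  simp [phantomRipple]

/-- A phantom ripple is continuous. [folklore] -/
theorem continuous_phantomRipple (ps : List (ℝ × ℝ)) : Continuous (phantomRipple ps) := by
  induction ps with
  | nil =>
    have e : phantomRipple [] = fun _ : ℝ ↦ (0 : ℝ) := by funext t; exact phantomRipple_nil t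
    rw [e]
    exact continuous_const
  | cons p ps ih =>
    have e : phantomRipple (p :: ps) = fun t ↦ p.1 * Real.cos (t * p.2) + phantomRipple ps t := by
      funext t; exact phantomRipple_cons p ps t
    rw [e]
    exact ((continuous_const.mul (Real.continuous_cos.comp (continuous_id.mul continuous_const))).add ih)

/-- A phantom ripple is bounded by the sum of the absolute amplitudes. [folklore] -/
theorem abs_phantomRipple_le (ps : List (ℝ × ℝ)) (t : ℝ) :
    |phantomRipple ps t| ≤ (ps.map fun p ↦ |p.1|).sum := by
  induction ps with
  | nil => simp
  | cons p ps ih =>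
    rw [phantomRipple_cons, List.map_cons, List.sum_cons]
    refine (abs_add_le _ _).trans (add_le_add ?_ ih)
    rw [abs_mul]
    exact mul_le_of_le_one_right (abs_nonneg _) (Real.abs_cos_le_one _)

/-- `t ↦ |ĝ(1/2+it)|² P(t)` is integrable for every phantom ripple `P`. [folklore] -/
theorem integrable_norm_sq_weilMellin_mul_phantomRipple (hg : IsWeilTest g) (ps : List (ℝ × ℝ)) :
    Integrable fun t : ℝ ↦ ‖weilMellin g (1 / 2 + t * I)‖ ^ 2 * phantomRipple ps t := by
  induction ps with
  | nil => simp
  | cons p ps ih =>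
    have e : (fun t : ℝ ↦ ‖weilMellin g (1 / 2 + t * I)‖ ^ 2 * phantomRipple (p :: ps) t) =
        fun t : ℝ ↦ ‖weilMellin g (1 / 2 + t * I)‖ ^ 2 * (p.1 * Real.cos (t * p.2)) +
          ‖weilMellin g (1 / 2 + t * I)‖ ^ 2 * phantomRipple ps t := by
      funext t; rw [phantomRipple_cons]; ring
    rw [e]
    exact (integrable_norm_sq_weilMellin_mul_const_mul_cos hg p.1 p.2).add ih

/-- **Phantom ripples are invisible**: if every frequency satisfies `2c ≤ |x_m|` and
`tsupport g ⊆ [-c, c]`, then `∫ |ĝ(1/2+it)|² P(t) dt = 0`. [folklore] -/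
theorem integral_norm_sq_weilMellin_mul_phantomRipple_eq_zero (hg : IsWeilTest g) {c : ℝ}
    (hsupp : tsupport g ⊆ Icc (-c) c) {ps : List (ℝ × ℝ)} (hps : ∀ p ∈ ps, 2 * c ≤ |p.2|) :
    ∫ t : ℝ, ‖weilMellin g (1 / 2 + t * I)‖ ^ 2 * phantomRipple ps t = 0 := by
  induction ps with
  | nil => simp
  | cons p ps ih =>
    have e : (fun t : ℝ ↦ ‖weilMellin g (1 / 2 + t * I)‖ ^ 2 * phantomRipple (p :: ps) t) =
        fun t : ℝ ↦ ‖weilMellin g (1 / 2 + t * I)‖ ^ 2 * (p.1 * Real.cos (t * p.2)) +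
          ‖weilMellin g (1 / 2 + t * I)‖ ^ 2 * phantomRipple ps t := by
      funext t; rw [phantomRipple_cons]; ring
    rw [e, integral_add (integrable_norm_sq_weilMellin_mul_const_mul_cos hg p.1 p.2)
      (integrable_norm_sq_weilMellin_mul_phantomRipple hg ps),
      integral_norm_sq_weilMellin_mul_const_mul_cos_eq_zero hg p.1 hsupp (hps p (by simp)),
      ih fun q hq ↦ hps q (by simp [hq]), add_zero]

/-- **Invariance of every analytic form under phantom ripples.** For any weight `w` against which `|ĝ|²` is
integrable, `∫ |ĝ|² (w + P) = ∫ |ĝ|² w` on the cone `C(c)` when all frequencies of `P` are `≥ 2c` in absolute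
value. [folklore] -/
theorem integral_norm_sq_weilMellin_mul_add_phantomRipple (hg : IsWeilTest g) {c : ℝ}
    (hsupp : tsupport g ⊆ Icc (-c) c) {w : ℝ → ℝ}
    (hw : Integrable fun t : ℝ ↦ ‖weilMellin g (1 / 2 + t * I)‖ ^ 2 * w t)
    {ps : List (ℝ × ℝ)} (hps : ∀ p ∈ ps, 2 * c ≤ |p.2|) :
    ∫ t : ℝ, ‖weilMellin g (1 / 2 + t * I)‖ ^ 2 * (w t + phantomRipple ps t) =
      ∫ t : ℝ, ‖weilMellin g (1 / 2 + t * I)‖ ^ 2 * w t := by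
  have e : (fun t : ℝ ↦ ‖weilMellin g (1 / 2 + t * I)‖ ^ 2 * (w t + phantomRipple ps t)) =
      fun t : ℝ ↦ ‖weilMellin g (1 / 2 + t * I)‖ ^ 2 * w t +
        ‖weilMellin g (1 / 2 + t * I)‖ ^ 2 * phantomRipple ps t := by
    funext t; ring
  rw [e, integral_add hw (integrable_norm_sq_weilMellin_mul_phantomRipple hg ps),
    integral_norm_sq_weilMellin_mul_phantomRipple_eq_zero hg hsupp hps, add_zero]

/-! ## The finite-prime and two-prime weights with phantoms -/

/-- **The finite-prime analytic form is blind to phantom ripples**: on `C(c)`,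
`∫ |ĝ|² (w_N + P) = ∫ |ĝ|² w_N` whenever every frequency of `P` is `≥ 2c` in absolute value. [folklore] -/
theorem integral_norm_sq_weilMellin_mul_weilFinitePrimeWeight_add_phantomRipple (hg : IsWeilTest g)
    (N : ℕ) {c : ℝ} (hsupp : tsupport g ⊆ Icc (-c) c) {ps : List (ℝ × ℝ)}
    (hps : ∀ p ∈ ps, 2 * c ≤ |p.2|) :
    ∫ t : ℝ, ‖weilMellin g (1 / 2 + t * I)‖ ^ 2 * (weilFinitePrimeWeight N t + phantomRipple ps t) =
      ∫ t : ℝ, ‖weilMellin g (1 / 2 + t * I)‖ ^ 2 * weilFinitePrimeWeight N t :=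
  integral_norm_sq_weilMellin_mul_add_phantomRipple hg hsupp
    (integrable_norm_sq_weilMellin_mul_weilFinitePrimeWeight hg N) hps

/-- **The two-prime weight with phantoms**: on `C(c)`, `∫ |ĝ|² (w₂₃ + P) = ∫ |ĝ|² w₂₃` whenever every
frequency of `P` is `≥ 2c` in absolute value (for instance `P` a cosine polynomial in the harmonics
`cos(j t log 2)`, `j log 2 ≥ 2c`, and `cos(k t log 3)`, `k log 3 ≥ 2c`). [folklore] -/
theorem integral_norm_sq_weilMellin_mul_weilTwoPrimeWeight_add_phantomRipple (hg : IsWeilTest g)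
    {c : ℝ} (hsupp : tsupport g ⊆ Icc (-c) c) {ps : List (ℝ × ℝ)} (hps : ∀ p ∈ ps, 2 * c ≤ |p.2|) :
    ∫ t : ℝ, ‖weilMellin g (1 / 2 + t * I)‖ ^ 2 * (weilTwoPrimeWeight t + phantomRipple ps t) =
      ∫ t : ℝ, ‖weilMellin g (1 / 2 + t * I)‖ ^ 2 * weilTwoPrimeWeight t :=
  integral_norm_sq_weilMellin_mul_add_phantomRipple hg hsupp
    (integrable_norm_sq_weilMellin_mul_weilTwoPrimeWeight hg) hps

end Summit.RiemannHypothesis.RiemannHypothesis.Theorems.EvenWinsBeyondArch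

end
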